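import Literature.Barriers.PneNP.SatPolytopeXCLowerBound
import Literature.Barriers.PneNP.ExtendedFormulationMinkowskiFaces
import HarnessLib

/-!
# Subset-sum and knapsack polytopes with extension complexity `2^{Ω(√n)}`
# (Avis–Tiwary 2015, Theorem 6 and Corollary 2)

[cite: AvisTiwary2015, §3.2, Thm. 6 and Cor. 2 (arXiv:1302.2340 pp. 8–9; lit-read p0008 L39–80,
p0009 L1–15)]

D. Avis, H. R. Tiwary, *On the extension complexity of combinatorial polytopes*, Math. Program. 153
(2015), §3.2.  "Define the subset sum polytope `SUBSETSUM(A,b)` as the convex hull of all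
characteristic vectors of the subsets of `A` whose sum is exactly `b`.
`SUBSETSUM(A,b) := conv({x ∈ [0,1]ⁿ | Σ a_i x_i = b})` … Note that this polytope is a face of the
knapsack polytope `KNAPSACK(A,b) := conv({x ∈ [0,1]ⁿ | Σ a_i x_i ≤ b})`."
"**Theorem 6.** For every 3SAT formula `Φ` with `n` variables and `m` clauses, there exists a set of
integers `A(Φ)` and integer `b` with `|A| = 2n + 2m` such that `SAT(Φ)` is the projection of
`SUBSETSUM(A,b)`."  (Standard reduction, [CLRS] §34.5.5: `(n+m)`-digit numbers in base `10`;
`b` has digit `1` at every variable and `4` at every clause; `v_i` / `v'_i` have digit `1` at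
variable `i` and at the clauses containing `x_i` / `¬x_i`; `s_j`, `s'_j` have digit `1`, `2` at
clause `j`.)  "**Corollary 2.** For every natural number `n ≥ 1`, there exists an instance `A, b`
of the subset-sum problem with `O(n)` integers in `A` such that `xc(SUBSETSUM(A,b)) ≥ 2^{Ω(√n)}`."
"… the polytope `SUBSETSUM(A,b)` is a face of `KNAPSACK(A,b)` and hence Corollary 2 implies a
superpolynomial lower bound for the Knapsack polytope."

## What is proved (everything; no named facts)

* `subsetSumPolytope a b`, `knapsackPolytope a b` (weights `a : A → ℕ`, `b : ℕ`), and
  `knapsackPolytope_inter_eq : KNAPSACK ∩ {Σ a_i x_i = b} = SUBSETSUM` (the face) with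
  `HasEFOfSize.subsetSum_of_knapsack`;
* the reduction `SubsetSumSat.weight Φ : Item Φ → ℕ`, `SubsetSumSat.target Φ` for a CNF `Φ` over a
  finite variable type `ν` (items `Item Φ = (ν × Bool) ⊕ (Fin |Φ| × Bool)`: `inl (i, true) = v_i`,
  `inl (i, false) = v'_i`, `inr (j, false) = s_j`, `inr (j, true) = s'_j`; `|Item Φ| = 2n + 2m`),
  the digit bookkeeping (`sum_weight : Σ_{k ∈ y} a_k = val (colsum y)`, `val_inj`: base-`10`
  representations with digits `≤ 9` are unique), and both halves of the printed argument
  (`eval_of_colsum`, `colsum_sel`);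
* **Theorem 6**: `AvisTiwary2015_thm6` — for `Φ` of width `≤ 3`, projecting `SUBSETSUM(A(Φ), b)` onto
  the coordinates `v_i` gives exactly `SAT(Φ)` (`SubsetSumSat.proj_image`), hence
  `xc(SUBSETSUM(A(Φ),b)) ≥ xc(SAT(Φ))`;
* **Corollary 2** (explicit form, with the formula `Φ_{n+1}` of `SatPolytopeXCLowerBound.lean`):
  `AvisTiwary2015_cor2` — an instance with `10(n+1)² − 8(n+1)` integers all of whose extended
  formulations (of `SUBSETSUM`, and of `KNAPSACK`) have size `r ≥ (3/2)ⁿ − 1`.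
-/

noncomputable section

namespace Literature.Barriers.PneNP

open Matrix Finset
open Literature.Computability.Complexity (Literal Clause CNF)

/-! ### Subset-sum and knapsack polytopes -/

section Polytopes

variable {A : Type} [Fintype A]

/-- The sum `Σ_{k : y_k = 1} a_k` of the selected weights. [cite: AvisTiwary2015, §3.2 (arXiv p. 8)] -/
def selSum (a : A → ℕ) (y : A → Bool) : ℕ := ∑ k, if y k then a k else 0

/-- **The subset-sum polytope** `SUBSETSUM(A,b) := conv{x ∈ {0,1}^A : Σ a_k x_k = b}`.
[cite: AvisTiwary2015, §3.2 (arXiv p. 8, lit-read p0008 L43)] -/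
def subsetSumPolytope (a : A → ℕ) (b : ℕ) : Set (A → ℝ) :=
  convexHull ℝ {x | ∃ y : A → Bool, selSum a y = b ∧ x = assignVec y}

/-- **The knapsack polytope** `KNAPSACK(A,b) := conv{x ∈ {0,1}^A : Σ a_k x_k ≤ b}`.
[cite: AvisTiwary2015, §3.2 (arXiv p. 8, lit-read p0008 L45)] -/
def knapsackPolytope (a : A → ℕ) (b : ℕ) : Set (A → ℝ) :=
  convexHull ℝ {x | ∃ y : A → Bool, selSum a y ≤ b ∧ x = assignVec y}

/-- `⟨a, x^y⟩ = Σ_{k ∈ y} a_k`. [cite: AvisTiwary2015, §3.2 (arXiv p. 8)] -/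
theorem natCast_dotProduct_assignVec (a : A → ℕ) (y : A → Bool) :
    (fun k => (a k : ℝ)) ⬝ᵥ assignVec y = (selSum a y : ℝ) := by
  unfold dotProduct assignVec selSum
  push_cast
  refine Finset.sum_congr rfl fun k _ => ?_
  split_ifs <;> simp

/-- "`SUBSETSUM(A,b)` is a face of `KNAPSACK(A,b)`": the knapsack inequality `Σ a_k x_k ≤ b` is valid
and cuts out exactly the subset-sum polytope. [cite: AvisTiwary2015, §3.2 (arXiv p. 8, lit-read p0008 L44–45)] -/
theorem knapsackPolytope_inter_eq (a : A → ℕ) (b : ℕ) :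
    knapsackPolytope a b ∩ {x | (fun k => (a k : ℝ)) ⬝ᵥ x = b} = subsetSumPolytope a b := by
  classical
  set S : Finset (A → ℝ) := (univ.filter fun y : A → Bool => selSum a y ≤ b).image assignVec
    with hS
  have hK : knapsackPolytope a b = convexHull ℝ (S : Set (A → ℝ)) := by
    unfold knapsackPolytope
    congr 1
    ext x
    simp only [Set.mem_setOf_eq, hS, Finset.coe_image, Finset.coe_filter, Finset.mem_univ,
      true_and, Set.mem_image]
    constructor
    · rintro ⟨y, hy, rfl⟩; exact ⟨y, hy, rfl⟩
    · rintro ⟨y, hy, rfl⟩; exact ⟨y, hy, rfl⟩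
  have hval : ∀ s ∈ S, (fun k => (a k : ℝ)) ⬝ᵥ s ≤ (b : ℝ) := by
    intro s hs
    simp only [hS, Finset.mem_image, Finset.mem_filter, Finset.mem_univ, true_and] at hs
    obtain ⟨y, hy, rfl⟩ := hs
    rw [natCast_dotProduct_assignVec]
    exact_mod_cast hy
  rw [hK, convexHull_inter_dotProduct_eq_of_valid S _ _ hval]
  unfold subsetSumPolytope
  congr 1
  ext x
  simp only [Finset.coe_filter, Set.mem_setOf_eq, hS, Finset.mem_image, Finset.mem_filter,
    Finset.mem_univ, true_and]
  constructor
  · rintro ⟨⟨y, -, rfl⟩, hx⟩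
    rw [natCast_dotProduct_assignVec] at hx
    exact ⟨y, by exact_mod_cast hx, rfl⟩
  · rintro ⟨y, hy, rfl⟩
    refine ⟨⟨y, hy.le, rfl⟩, ?_⟩
    rw [natCast_dotProduct_assignVec, hy]

/-- `xc(KNAPSACK(A,b)) ≥ xc(SUBSETSUM(A,b))` (faces, Proposition 2).
[cite: AvisTiwary2015, §3.2 with Prop. 2 (arXiv pp. 6, 9)] -/
theorem HasEFOfSize.subsetSum_of_knapsack {a : A → ℕ} {b : ℕ} {r : ℕ}
    (h : HasEFOfSize (knapsackPolytope a b) r) : HasEFOfSize (subsetSumPolytope a b) r := by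
  have h1 := h.inter_eqs (T := Unit) (fun _ k => (a k : ℝ)) (fun _ => (b : ℝ))
  rw [← knapsackPolytope_inter_eq]
  convert h1 using 3
  ext x
  simp

end Polytopes

/-! ### Base-`10` digit bookkeeping -/

/-- Base-`10` representations with digits `≤ 9` are unique. [cite: AvisTiwary2015, §3.2, proof of Thm. 6 (arXiv p. 8)] -/
theorem digits_inj {L : ℕ} {f g : Fin L → ℕ} (hf : ∀ t, f t ≤ 9) (hg : ∀ t, g t ≤ 9)
    (h : ∑ t, f t * 10 ^ (t : ℕ) = ∑ t, g t * 10 ^ (t : ℕ)) : f = g := by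
  induction L with
  | zero => funext t; exact t.elim0
  | succ L ih =>
    rw [Fin.sum_univ_succ, Fin.sum_univ_succ] at h
    simp only [Fin.val_zero, pow_zero, mul_one, Fin.val_succ, pow_succ] at h
    have hsum : ∀ u : Fin L → ℕ,
        ∑ t : Fin L, u t * (10 ^ (t : ℕ) * 10) = 10 * ∑ t, u t * 10 ^ (t : ℕ) := by
      intro u
      rw [Finset.mul_sum]
      exact Finset.sum_congr rfl fun t _ => by ring
    rw [hsum (fun t => f t.succ), hsum (fun t => g t.succ)] at h
    have hf0 := hf 0
    have hg0 := hg 0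
    have h0 : f 0 = g 0 := by omega
    have hrest : ∑ t : Fin L, f t.succ * 10 ^ (t : ℕ) = ∑ t : Fin L, g t.succ * 10 ^ (t : ℕ) := by
      omega
    have htail := ih (fun t => hf _) (fun t => hg _) hrest
    funext t
    refine Fin.cases h0 (fun t' => ?_) t
    exact congrFun htail t'

/-! ### The reduction `3SAT → SUBSETSUM` -/

namespace SubsetSumSat

variable {ν : Type} [Fintype ν] [DecidableEq ν] (Φ : CNF ν)

/-- The items: `inl (i, true) = v_i`, `inl (i, false) = v'_i` (`i` a variable),
`inr (j, false) = s_j`, `inr (j, true) = s'_j` (`j` a clause).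
[cite: AvisTiwary2015, §3.2, proof of Thm. 6 (arXiv p. 8)] -/
abbrev Item : Type := (ν × Bool) ⊕ (Fin Φ.length × Bool)

/-- The digit positions: one per variable, one per clause.
[cite: AvisTiwary2015, §3.2, proof of Thm. 6 (arXiv p. 8)] -/
abbrev Pos : Type := ν ⊕ Fin Φ.length

/-- The digits of the items: `v_i`, `v'_i` have digit `1` at variable `i` and at the clauses
containing the literal `x_i`, `¬x_i` respectively; `s_j`, `s'_j` have digit `1`, `2` at clause `j`.
[cite: AvisTiwary2015, §3.2, proof of Thm. 6 (arXiv p. 8, the numbers `v_{ij}, v'_{ij}, s_{ij}, s'_{ij}`)] -/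
def digit : Item Φ → Pos Φ → ℕ
  | .inl (i, _), .inl i' => if i' = i then 1 else 0
  | .inl (i, pol), .inr j => if ((i, pol) : Literal ν) ∈ Φ.get j then 1 else 0
  | .inr _, .inl _ => 0
  | .inr (j, false), .inr j' => if j' = j then 1 else 0
  | .inr (j, true), .inr j' => if j' = j then 2 else 0

/-- The digits of `b`: `1` at every variable, `4` at every clause.
[cite: AvisTiwary2015, §3.2, proof of Thm. 6 (arXiv p. 8, the number `b_j`)] -/
def tgt : Pos Φ → ℕ
  | .inl _ => 1
  | .inr _ => 4

/-- The base-`10` value of a digit vector (positions numbered by `Fintype.equivFin`).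
[cite: AvisTiwary2015, §3.2, proof of Thm. 6 ("(n+m)-digit number (in base 10)")] -/
def val (d : Pos Φ → ℕ) : ℕ := ∑ p, d p * 10 ^ (Fintype.equivFin (Pos Φ) p : ℕ)

/-- The weights `A(Φ)`. [cite: AvisTiwary2015, §3.2, Thm. 6 (arXiv p. 8)] -/
def weight (k : Item Φ) : ℕ := val Φ (digit Φ k)

/-- The target `b`. [cite: AvisTiwary2015, §3.2, Thm. 6 (arXiv p. 8)] -/
def target : ℕ := val Φ (tgt Φ)

omit [DecidableEq ν] in
/-- "`|A| = 2n + 2m`". [cite: AvisTiwary2015, §3.2, Thm. 6 (arXiv p. 8)] -/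
theorem card_item : Fintype.card (Item Φ) = 2 * Fintype.card ν + 2 * Φ.numClauses := by
  simp only [Fintype.card_sum, Fintype.card_prod, Fintype.card_bool, Fintype.card_fin,
    CNF.numClauses]
  ring

omit [DecidableEq ν] in
/-- Base-`10` values determine digit vectors with digits `≤ 9` (no carries).
[cite: AvisTiwary2015, §3.2, proof of Thm. 6 (arXiv p. 8)] -/
theorem val_inj {c d : Pos Φ → ℕ} (hc : ∀ p, c p ≤ 9) (hd : ∀ p, d p ≤ 9)
    (h : val Φ c = val Φ d) : c = d := by
  set e := Fintype.equivFin (Pos Φ) with he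
  have h' : ∑ t, c (e.symm t) * 10 ^ (t : ℕ) = ∑ t, d (e.symm t) * 10 ^ (t : ℕ) := by
    unfold val at h
    rw [← e.sum_comp (fun t => c (e.symm t) * 10 ^ (t : ℕ)),
      ← e.sum_comp (fun t => d (e.symm t) * 10 ^ (t : ℕ))]
    simpa only [Equiv.symm_apply_apply] using h
  have := digits_inj (fun t => hc _) (fun t => hd _) h'
  funext p
  have hp := congrFun this (e p)
  simpa only [Equiv.symm_apply_apply] using hp

/-- The column sums of a selection `y` of items. [cite: AvisTiwary2015, §3.2, proof of Thm. 6 (arXiv p. 8)] -/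
def colsum (y : Item Φ → Bool) (p : Pos Φ) : ℕ := ∑ k, if y k then digit Φ k p else 0

/-- `Σ_{k ∈ y} a_k` is the base-`10` number with digits the column sums of `y`.
[cite: AvisTiwary2015, §3.2, proof of Thm. 6 (arXiv p. 8)] -/
theorem selSum_weight (y : Item Φ → Bool) : selSum (weight Φ) y = val Φ (colsum Φ y) := by
  unfold selSum weight val colsum
  have h1 : ∀ k : Item Φ, (if y k then ∑ p, digit Φ k p * 10 ^ (Fintype.equivFin (Pos Φ) p : ℕ)
      else 0) = ∑ p, (if y k then digit Φ k p else 0) * 10 ^ (Fintype.equivFin (Pos Φ) p : ℕ) := by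
    intro k
    split_ifs
    · rfl
    · simp
  simp_rw [h1]
  rw [Finset.sum_comm]
  refine Finset.sum_congr rfl fun p _ => ?_
  rw [Finset.sum_mul]

/-- The number of literals of clause `j` selected by `y` (via their items `v_i` / `v'_i`).
[cite: AvisTiwary2015, §3.2, proof of Thm. 6 (arXiv p. 8)] -/
def litCount (y : Item Φ → Bool) (j : Fin Φ.length) : ℕ :=
  ∑ l : ν × Bool, if y (.inl l) = true ∧ l ∈ Φ.get j then 1 else 0

/-- Column sum at a variable: `[v_i ∈ y] + [v'_i ∈ y]`.
[cite: AvisTiwary2015, §3.2, proof of Thm. 6 (arXiv p. 8)] -/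
theorem colsum_inl (y : Item Φ → Bool) (i : ν) :
    colsum Φ y (.inl i) =
      (if y (.inl (i, true)) then 1 else 0) + (if y (.inl (i, false)) then 1 else 0) := by
  unfold colsum
  rw [Fintype.sum_sum_type]
  have h2 : ∑ k : Fin Φ.length × Bool, (if y (.inr k) then digit Φ (.inr k) (.inl i) else 0) = 0 :=
    Finset.sum_eq_zero fun k _ => by simp [digit]
  rw [h2, add_zero, Fintype.sum_prod_type, Finset.sum_eq_single i]
  · rw [Fintype.sum_bool]
    simp [digit]
  · intro i' _ hi'
    have hne : i ≠ i' := fun h => hi' h.symm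
    simp [digit, hne]
  · simp

/-- Column sum at a clause: `litCount + [s_j ∈ y] + 2 [s'_j ∈ y]`.
[cite: AvisTiwary2015, §3.2, proof of Thm. 6 (arXiv p. 8)] -/
theorem colsum_inr (y : Item Φ → Bool) (j : Fin Φ.length) :
    colsum Φ y (.inr j) = litCount Φ y j +
      ((if y (.inr (j, false)) then 1 else 0) + 2 * (if y (.inr (j, true)) then 1 else 0)) := by
  unfold colsum litCount
  rw [Fintype.sum_sum_type]
  congr 1
  · refine Finset.sum_congr rfl fun l _ => ?_
    rcases l with ⟨i, pol⟩
    simp only [digit]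
    by_cases h1 : y (.inl (i, pol)) = true
    · by_cases h2 : ((i, pol) : ν × Bool) ∈ Φ.get j
      · rw [if_pos h1, if_pos h2, if_pos ⟨h1, h2⟩]
      · rw [if_pos h1, if_neg h2, if_neg (fun h => h2 h.2)]
    · rw [if_neg h1, if_neg (fun h => h1 h.1)]
  · rw [Fintype.sum_prod_type, Finset.sum_eq_single j]
    · rw [Fintype.sum_bool]
      by_cases h1 : y (.inr (j, true)) = true <;> by_cases h2 : y (.inr (j, false)) = true <;>
        simp [digit, h1, h2]
    · intro j' _ hj'
      have hne : j ≠ j' := fun h => hj' h.symm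
      simp [digit, hne]
    · simp

/-- A clause of width `≤ 3` has at most `3` selected literals.
[cite: AvisTiwary2015, §3.2, proof of Thm. 6 (arXiv p. 8)] -/
theorem litCount_le (hΦ : Φ.IsWidthLE 3) (y : Item Φ → Bool) (j : Fin Φ.length) :
    litCount Φ y j ≤ 3 := by
  unfold litCount
  calc ∑ l : ν × Bool, (if y (.inl l) = true ∧ l ∈ Φ.get j then 1 else 0)
      ≤ ∑ l : ν × Bool, (if l ∈ (Φ.get j).toFinset then 1 else 0) :=
        Finset.sum_le_sum fun l _ => by
          split_ifs with h1 h2 h3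
          · exact le_rfl
          · exact absurd (List.mem_toFinset.mpr h1.2) h2
          · exact Nat.zero_le _
          · exact le_rfl
    _ = (Φ.get j).toFinset.card := by
        rw [Finset.sum_boole, Nat.cast_id, Finset.filter_mem_eq_inter, Finset.univ_inter]
    _ ≤ (Φ.get j).length := List.toFinset_card_le _
    _ ≤ 3 := hΦ _ (List.get_mem Φ j)

/-- All column sums are digits (`≤ 9`). [cite: AvisTiwary2015, §3.2, proof of Thm. 6 (arXiv p. 8)] -/
theorem colsum_le (hΦ : Φ.IsWidthLE 3) (y : Item Φ → Bool) (p : Pos Φ) : colsum Φ y p ≤ 9 := by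
  rcases p with i | j
  · rw [colsum_inl]
    split_ifs <;> simp
  · rw [colsum_inr]
    have := litCount_le Φ hΦ y j
    split_ifs <;> omega

omit [Fintype ν] [DecidableEq ν] in
/-- The digits of `b` are `≤ 9`. [cite: AvisTiwary2015, §3.2, proof of Thm. 6 (arXiv p. 8)] -/
theorem tgt_le (p : Pos Φ) : tgt Φ p ≤ 9 := by
  rcases p with i | j <;> simp [tgt]

/-- The assignment read off a selection: `x_i := [v_i ∈ y]`.
[cite: AvisTiwary2015, §3.2, Thm. 6 (arXiv p. 8: "`SAT(Φ)` is the projection of `SUBSETSUM(A,b)`")] -/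
def assignOf (y : Item Φ → Bool) : ν → Bool := fun i => y (.inl (i, true))

/-- **A subset summing to `b` projects to a satisfying assignment.**  If the column sums of `y` are
the digits of `b` then `x_i := [v_i ∈ y]` satisfies `Φ`.
[cite: AvisTiwary2015, §3.2, proof of Thm. 6 (arXiv p. 8)] -/
theorem eval_of_colsum {y : Item Φ → Bool} (h : colsum Φ y = tgt Φ) :
    Φ.eval (assignOf Φ y) = true := by
  rw [CNF.eval_eq_true_iff]
  intro c hc
  obtain ⟨j, rfl⟩ := List.mem_iff_get.mp hc
  -- the clause column: `litCount + [s_j] + 2[s'_j] = 4`, so some literal item is selected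
  have hj := congrFun h (.inr j)
  rw [colsum_inr] at hj
  simp only [tgt] at hj
  have hpos : litCount Φ y j ≠ 0 := by
    intro h0; rw [h0] at hj; split_ifs at hj <;> omega
  obtain ⟨⟨i, pol⟩, -, hl⟩ := Finset.exists_ne_zero_of_sum_ne_zero hpos
  simp only [ne_eq, ite_eq_right_iff, one_ne_zero, imp_false, not_not] at hl
  obtain ⟨hy, hmem⟩ := hl
  -- the variable column: exactly one of `v_i`, `v'_i` is selected
  have hi := congrFun h (.inl i)
  rw [colsum_inl] at hi
  simp only [tgt] at hi
  unfold Clause.eval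
  rw [List.any_eq_true]
  refine ⟨(i, pol), hmem, ?_⟩
  unfold Literal.eval assignOf
  cases pol
  · -- `¬x_i` selected, so `v_i` is not: `x_i = 0`
    rw [hy] at hi
    have : y (.inl (i, true)) = false := by
      cases h' : y (.inl (i, true))
      · rfl
      · rw [h'] at hi; simp at hi
    rw [this]; rfl
  · rw [hy]; rfl

/-- The number of TRUE literals of clause `j` under `σ`.
[cite: AvisTiwary2015, §3.2, proof of Thm. 6 (arXiv p. 8)] -/
def litTrue (σ : ν → Bool) (j : Fin Φ.length) : ℕ :=
  ∑ l : ν × Bool, if σ l.1 = l.2 ∧ l ∈ Φ.get j then 1 else 0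

/-- The selection of a satisfying assignment: `v_i` or `v'_i` according to `x_i`, and the slack
items `s_j`, `s'_j` topping the clause column (`1, 2` or `3` true literals) up to `4`.
[cite: AvisTiwary2015, §3.2, proof of Thm. 6 (arXiv p. 8)] -/
def sel (σ : ν → Bool) : Item Φ → Bool
  | .inl (i, pol) => decide (σ i = pol)
  | .inr (j, false) => decide (litTrue Φ σ j = 1 ∨ litTrue Φ σ j = 3)
  | .inr (j, true) => decide (litTrue Φ σ j ≤ 2)

/-- `litCount (sel σ) = litTrue σ`. [cite: AvisTiwary2015, §3.2, proof of Thm. 6 (arXiv p. 8)] -/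
theorem litCount_sel (σ : ν → Bool) (j : Fin Φ.length) :
    litCount Φ (sel Φ σ) j = litTrue Φ σ j := by
  unfold litCount litTrue
  refine Finset.sum_congr rfl fun l _ => ?_
  rcases l with ⟨i, pol⟩
  simp [sel]

/-- A satisfied clause has at least one true literal. [cite: AvisTiwary2015, §3.2, proof of Thm. 6] -/
theorem one_le_litTrue {σ : ν → Bool} (hσ : Φ.eval σ = true) (j : Fin Φ.length) :
    1 ≤ litTrue Φ σ j := by
  rw [CNF.eval_eq_true_iff] at hσ
  have hc := hσ _ (List.get_mem Φ j)
  unfold Clause.eval at hc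
  rw [List.any_eq_true] at hc
  obtain ⟨⟨i, pol⟩, hmem, hl⟩ := hc
  unfold Literal.eval at hl
  simp only [beq_iff_eq] at hl
  unfold litTrue
  calc 1 = (if σ (i, pol).1 = (i, pol).2 ∧ ((i, pol) : ν × Bool) ∈ Φ.get j then 1 else 0) :=
        (if_pos ⟨hl, hmem⟩).symm
    _ ≤ ∑ l : ν × Bool, (if σ l.1 = l.2 ∧ l ∈ Φ.get j then 1 else 0) :=
        Finset.single_le_sum (f := fun l : ν × Bool => if σ l.1 = l.2 ∧ l ∈ Φ.get j then 1 else 0)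
          (fun _ _ => Nat.zero_le _) (Finset.mem_univ _)

/-- **A satisfying assignment extends to a subset summing to `b`.**
[cite: AvisTiwary2015, §3.2, proof of Thm. 6 (arXiv p. 8)] -/
theorem colsum_sel (hΦ : Φ.IsWidthLE 3) {σ : ν → Bool} (hσ : Φ.eval σ = true) :
    colsum Φ (sel Φ σ) = tgt Φ := by
  funext p
  rcases p with i | j
  · rw [colsum_inl]
    simp only [sel, tgt, decide_eq_true_eq]
    cases σ i <;> simp
  · rw [colsum_inr, litCount_sel]
    have h1 := one_le_litTrue Φ hσ j
    have h3 : litTrue Φ σ j ≤ 3 := by rw [← litCount_sel]; exact litCount_le Φ hΦ _ j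
    simp only [sel, tgt, decide_eq_true_eq]
    split_ifs <;> omega

/-- The projection onto the coordinates `v_i` ("`SAT(Φ)` is the projection of `SUBSETSUM(A,b)`").
[cite: AvisTiwary2015, §3.2, Thm. 6 (arXiv p. 8)] -/
def proj : (Item Φ → ℝ) →ₗ[ℝ] (ν → ℝ) :=
  LinearMap.funLeft ℝ ℝ fun i : ν => (.inl (i, true) : Item Φ)

omit [Fintype ν] [DecidableEq ν] in
/-- `proj (x^y) = x^{assignOf y}`. [cite: AvisTiwary2015, §3.2, proof of Thm. 6 (arXiv p. 8)] -/
theorem proj_assignVec (y : Item Φ → Bool) : proj Φ (assignVec y) = assignVec (assignOf Φ y) := rfl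

/-- **Theorem 6 (the computation)**: the projection of `SUBSETSUM(A(Φ), b)` onto the coordinates
`v_i` is `SAT(Φ)`. [cite: AvisTiwary2015, §3.2, Thm. 6 (arXiv p. 8)] -/
theorem proj_image (hΦ : Φ.IsWidthLE 3) :
    proj Φ '' subsetSumPolytope (weight Φ) (target Φ) = satPolytope Φ := by
  unfold subsetSumPolytope satPolytope
  rw [LinearMap.image_convexHull]
  congr 1
  apply Set.Subset.antisymm
  · rintro _ ⟨_, ⟨y, hy, rfl⟩, rfl⟩
    refine ⟨assignOf Φ y, eval_of_colsum Φ ?_, proj_assignVec Φ y⟩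
    rw [selSum_weight] at hy
    exact val_inj Φ (colsum_le Φ hΦ y) (tgt_le Φ) hy
  · rintro _ ⟨σ, hσ, rfl⟩
    refine ⟨assignVec (sel Φ σ), ⟨sel Φ σ, ?_, rfl⟩, ?_⟩
    · rw [selSum_weight, colsum_sel Φ hΦ hσ]; rfl
    · rw [proj_assignVec]
      congr 1
      funext i
      simp [assignOf, sel]

end SubsetSumSat

open SubsetSumSat

/-- **Avis–Tiwary Theorem 6.**  For a 3SAT formula `Φ` (every clause of width `≤ 3`) with `n`
variables and `m` clauses, the `2n + 2m` integers `A(Φ) = SubsetSumSat.weight Φ` and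
`b = SubsetSumSat.target Φ` have `SAT(Φ)` as a projection of `SUBSETSUM(A(Φ), b)`; in particular
`xc(SUBSETSUM(A(Φ), b)) ≥ xc(SAT(Φ))` (Proposition 1).
[cite: AvisTiwary2015, §3.2, Thm. 6 (arXiv p. 8, lit-read p0008 L47)] -/
theorem AvisTiwary2015_thm6 {ν : Type} [Fintype ν] [DecidableEq ν] (Φ : CNF ν)
    (hΦ : Φ.IsWidthLE 3) :
    Fintype.card (Item Φ) = 2 * Fintype.card ν + 2 * Φ.numClauses ∧
      proj Φ '' subsetSumPolytope (weight Φ) (target Φ) = satPolytope Φ ∧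
      ∀ r : ℕ, HasEFOfSize (subsetSumPolytope (weight Φ) (target Φ)) r →
        HasEFOfSize (satPolytope Φ) r := by
  refine ⟨card_item Φ, proj_image Φ hΦ, fun r h => ?_⟩
  have := h.image_linearMap (proj Φ)
  rwa [proj_image Φ hΦ] at this

/-- **Avis–Tiwary Corollary 2** (explicit form) and the knapsack remark.  For the formula `Φ_{n+1}`
of Theorem 5 (`(n+1)²` variables, `4n(n+1)` clauses) the subset-sum instance `A(Φ_{n+1}), b` has
`10(n+1)² − 8(n+1)` integers, and every extended formulation of `SUBSETSUM(A,b)` — and of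
`KNAPSACK(A,b)`, of which it is a face — has size `r ≥ (3/2)ⁿ − 1`
("`O(n)` integers … `xc(SUBSETSUM(A,b)) ≥ 2^{Ω(√n)}`").
[cite: AvisTiwary2015, §3.2, Cor. 2 and the remark after it (arXiv p. 9, lit-read p0009 L13–15)] -/
theorem AvisTiwary2015_cor2 (n : ℕ) :
    Fintype.card (Item (SatCut.formula (n + 1))) = 10 * (n + 1) ^ 2 - 8 * (n + 1) ∧
      (∀ r : ℕ, HasEFOfSize (subsetSumPolytope (weight (SatCut.formula (n + 1)))
          (target (SatCut.formula (n + 1)))) r → (3 / 2 : ℝ) ^ n ≤ r + 1) ∧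
      ∀ r : ℕ, HasEFOfSize (knapsackPolytope (weight (SatCut.formula (n + 1)))
          (target (SatCut.formula (n + 1)))) r → (3 / 2 : ℝ) ^ n ≤ r + 1 := by
  have hw : (SatCut.formula (n + 1)).IsWidthLE 3 := (SatCut.formula_isExactWidth (n + 1)).isWidthLE
  have hss : ∀ r : ℕ, HasEFOfSize (subsetSumPolytope (weight (SatCut.formula (n + 1)))
      (target (SatCut.formula (n + 1)))) r → (3 / 2 : ℝ) ^ n ≤ r + 1 := fun r h =>
    cutPolytope_complete_xc_ge ((AvisTiwary2015_thm6 _ hw).2.2 r h).cutPolytope_of_sat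
  refine ⟨?_, hss, fun r h => hss r h.subsetSum_of_knapsack⟩
  rw [card_item, SatCut.card_vars, SatCut.numClauses_formula]
  have h1 : (n + 1) ≤ (n + 1) * (n + 1) := Nat.le_mul_self _
  have h2 : 8 * (n + 1) ≤ 10 * (n + 1) ^ 2 := by nlinarith
  zify [h1, h2]
  ring

end Literature.Barriers.PneNP
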